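import Summits.Ventures.Crystal3D.Theorems.StickyWulffConstantGenericWallFloorSharedTriangle
import Summits.Ventures.Crystal3D.Theorems.StickyWulffConstantGenericWallFloorSlotGeometry
import HarnessLib

/-!
# Two fcc lattices sharing an orthogonal slot pair coincide; non-co-axial grains share at most one
# slot axis (crux `GenericWallFloor`, line `WallLedgerG`)

HONEST FRAMING. Part of the venture `Summits/Ventures/Crystal3D` (cell `crystal3d-full`), helper
`--supports` the crux `GenericWallFloor` (stmt-Ventures-19480) of `route-Ventures-StickyWulffConstant`,
registered line `WallLedgerG` (planner cf-p1 gen 16).  Sequel of `…SharedTriangle` (a shared ADJACENT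
slot pair forces co-axiality).  Here: a shared ORTHOGONAL pair of unit vectors forces the two LINEAR
lattices to be EQUAL (`image_eq_of_shared_orthogonal_slots`: over a unit square an fcc lattice has both
octahedral apices, which pin the third generator), hence co-axial; and since two unit vectors of one fcc
lattice meet at `60°, 90°, 120°` or `180°`, the COMMON unit vectors («slots») of a NON-co-axial pair are
contained in one axis `{a, −a}` (`common_slots_antipodal_of_not_coaxial`) — the constraint on mixed
kissing dozens at coincidence sites of the slot ledger (seat 19480-p1's rigid rung).

Ingredients: the cubic frame of `…CubicFrame` / `…SlotGeometry` (integer slot coordinates, a kernel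
`decide` over the twelve slots for the two apices of a square: `square_apices_decide`), an orthonormal
frame through an orthogonal pair (`exists_frame_isometry_orth`), generator capture
(`image_const_eq_of_generators`).

WHAT THIS IS NOT: nothing about packings or walls; rung F-C1 not moved.
-/

noncomputable section

namespace Summit.Ventures.Crystal3D.Theorems

open Literature.MathematicalPhysics.StatisticalMechanics
open Literature.Barriers.AtomisticToContinuum (barlowAddSubgroupOfConst)
open scoped InnerProductSpace

/-! ### The two octahedral apices over a unit square of `Λ₀` (cubic frame, kernel `decide`) -/

/-- **Apices over a square, integer form.**  For two of the twelve cubic slot vectors with dot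
product `0` there are two different slot vectors with dot product `1` against both. -/
theorem square_apices_decide :
    ∀ X ∈ ([((1 : ℤ), (1 : ℤ), (0 : ℤ)), (1, -1, 0), (-1, 1, 0), (-1, -1, 0), (1, 0, 1), (1, 0, -1),
      (-1, 0, 1), (-1, 0, -1), (0, 1, 1), (0, 1, -1), (0, -1, 1), (0, -1, -1)] : List (ℤ × ℤ × ℤ)),
    ∀ Y ∈ ([((1 : ℤ), (1 : ℤ), (0 : ℤ)), (1, -1, 0), (-1, 1, 0), (-1, -1, 0), (1, 0, 1), (1, 0, -1),
      (-1, 0, 1), (-1, 0, -1), (0, 1, 1), (0, 1, -1), (0, -1, 1), (0, -1, -1)] : List (ℤ × ℤ × ℤ)),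
    X.1 * Y.1 + X.2.1 * Y.2.1 + X.2.2 * Y.2.2 = 0 →
    ∃ C ∈ ([((1 : ℤ), (1 : ℤ), (0 : ℤ)), (1, -1, 0), (-1, 1, 0), (-1, -1, 0), (1, 0, 1), (1, 0, -1),
      (-1, 0, 1), (-1, 0, -1), (0, 1, 1), (0, 1, -1), (0, -1, 1), (0, -1, -1)] : List (ℤ × ℤ × ℤ)),
    ∃ C' ∈ ([((1 : ℤ), (1 : ℤ), (0 : ℤ)), (1, -1, 0), (-1, 1, 0), (-1, -1, 0), (1, 0, 1), (1, 0, -1),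
      (-1, 0, 1), (-1, 0, -1), (0, 1, 1), (0, 1, -1), (0, -1, 1), (0, -1, -1)] : List (ℤ × ℤ × ℤ)),
      C ≠ C' ∧ C.1 * X.1 + C.2.1 * X.2.1 + C.2.2 * X.2.2 = 1 ∧ C.1 * Y.1 + C.2.1 * Y.2.1 + C.2.2 * Y.2.2 = 1 ∧
        C'.1 * X.1 + C'.2.1 * X.2.1 + C'.2.2 * X.2.2 = 1 ∧ C'.1 * Y.1 + C'.2.1 * Y.2.1 + C'.2.2 * Y.2.2 = 1 := by
  decide

/-- Integer triples of squared norm `2` are the twelve cubic slot vectors. -/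
theorem mem_slotList_of_sq_eq_two (a b c : ℤ) (h : a ^ 2 + b ^ 2 + c ^ 2 = 2) :
    (a, b, c) ∈ ([((1 : ℤ), (1 : ℤ), (0 : ℤ)), (1, -1, 0), (-1, 1, 0), (-1, -1, 0), (1, 0, 1), (1, 0, -1),
      (-1, 0, 1), (-1, 0, -1), (0, 1, 1), (0, 1, -1), (0, -1, 1), (0, -1, -1)] : List (ℤ × ℤ × ℤ)) := by
  have ha : -1 ≤ a ∧ a ≤ 1 := by constructor <;> nlinarith [sq_nonneg b, sq_nonneg c, sq_nonneg (a - 1), sq_nonneg (a + 1)]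
  have hb : -1 ≤ b ∧ b ≤ 1 := by constructor <;> nlinarith [sq_nonneg a, sq_nonneg c, sq_nonneg (b - 1), sq_nonneg (b + 1)]
  have hc : -1 ≤ c ∧ c ≤ 1 := by constructor <;> nlinarith [sq_nonneg a, sq_nonneg b, sq_nonneg (c - 1), sq_nonneg (c + 1)]
  have key : ∀ a₁ ∈ Finset.Icc (-1 : ℤ) 1, ∀ b₁ ∈ Finset.Icc (-1 : ℤ) 1, ∀ c₁ ∈ Finset.Icc (-1 : ℤ) 1,
      a₁ ^ 2 + b₁ ^ 2 + c₁ ^ 2 = 2 →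
      (a₁, b₁, c₁) ∈ ([((1 : ℤ), (1 : ℤ), (0 : ℤ)), (1, -1, 0), (-1, 1, 0), (-1, -1, 0), (1, 0, 1), (1, 0, -1),
        (-1, 0, 1), (-1, 0, -1), (0, 1, 1), (0, 1, -1), (0, -1, 1), (0, -1, -1)] : List (ℤ × ℤ × ℤ)) := by
    decide
  exact key a (Finset.mem_Icc.2 ha) b (Finset.mem_Icc.2 hb) c (Finset.mem_Icc.2 hc) h

/-- **A site from cubic coordinates, with its dictionary.**  Every even-sum integer triple is the cubic
coordinate vector of a site of `Λ₀`, whose norm and inner products are read off in the cubic frame. -/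
theorem exists_site_of_cubic (σ τ υ : ℤ) (h : Even (σ + τ + υ)) :
    ∃ w ∈ fccStacking 1 (Real.sqrt (2 / 3)),
      (w 0 + Real.sqrt 3 / 3 * w 1 - Real.sqrt (2 / 3) * w 2 = σ) ∧
      (w 0 - Real.sqrt 3 / 3 * w 1 + Real.sqrt (2 / 3) * w 2 = τ) ∧
      (2 * Real.sqrt 3 / 3 * w 1 + Real.sqrt (2 / 3) * w 2 = υ) := by
  obtain ⟨k, i, j, hij, hik, hjk⟩ := barlowPos_of_cubic σ τ υ h
  obtain ⟨hA, hB, hC⟩ := cubic_barlowPos k i j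
  refine ⟨_, barlowPos_mem k i j, ?_, ?_, ?_⟩
  · rw [hA, ← hij]; push_cast; ring
  · rw [hB, ← hik]; push_cast; ring
  · rw [hC, ← hjk]; push_cast; ring

/-- The twelve cubic slot vectors have even coordinate sum and squared norm `2`. -/
theorem slotList_props :
    ∀ C ∈ ([((1 : ℤ), (1 : ℤ), (0 : ℤ)), (1, -1, 0), (-1, 1, 0), (-1, -1, 0), (1, 0, 1), (1, 0, -1),
      (-1, 0, 1), (-1, 0, -1), (0, 1, 1), (0, 1, -1), (0, -1, 1), (0, -1, -1)] : List (ℤ × ℤ × ℤ)),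
      Even (C.1 + C.2.1 + C.2.2) ∧ C.1 ^ 2 + C.2.1 ^ 2 + C.2.2 ^ 2 = 2 := by
  decide

/-- **Over a unit square an fcc lattice has both apices.**  For orthogonal unit vectors `x, y ∈ Λ₀`
there are two different unit vectors `c ∈ Λ₀` with `⟪c, x⟫ = ⟪c, y⟫ = ½`. -/
theorem exists_two_apices {x y : EuclideanSpace ℝ (Fin 3)}
    (hx : x ∈ fccStacking 1 (Real.sqrt (2 / 3))) (hy : y ∈ fccStacking 1 (Real.sqrt (2 / 3)))
    (hx1 : ‖x‖ = 1) (hy1 : ‖y‖ = 1) (hxy : ⟪x, y⟫_ℝ = 0) :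
    ∃ c₁ ∈ fccStacking 1 (Real.sqrt (2 / 3)), ∃ c₂ ∈ fccStacking 1 (Real.sqrt (2 / 3)), c₁ ≠ c₂ ∧
      ‖c₁‖ = 1 ∧ ‖c₂‖ = 1 ∧ ⟪c₁, x⟫_ℝ = 1 / 2 ∧ ⟪c₁, y⟫_ℝ = 1 / 2 ∧ ⟪c₂, x⟫_ℝ = 1 / 2 ∧
      ⟪c₂, y⟫_ℝ = 1 / 2 := by
  obtain ⟨k, i, j, rfl⟩ := hx
  obtain ⟨k', i', j', rfl⟩ := hy
  obtain ⟨xa, xb, xc⟩ := cubic_barlowPos k i j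
  obtain ⟨ya, yb, yc⟩ := cubic_barlowPos k' i' j'
  have hxn := two_mul_norm_sq_eq_cubic (barlowPos 1 (Real.sqrt (2 / 3)) constHagg k i j)
  have hyn := two_mul_norm_sq_eq_cubic (barlowPos 1 (Real.sqrt (2 / 3)) constHagg k' i' j')
  have hdot := inner_eq_half_cubic (barlowPos 1 (Real.sqrt (2 / 3)) constHagg k i j)
    (barlowPos 1 (Real.sqrt (2 / 3)) constHagg k' i' j')
  rw [xa, xb, xc, hx1] at hxn
  rw [ya, yb, yc, hy1] at hyn
  rw [xa, xb, xc, ya, yb, yc, hxy] at hdot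
  have hX' : ((i : ℝ) + j) ^ 2 + ((i : ℝ) + k) ^ 2 + ((j : ℝ) + k) ^ 2 = 2 := by
    linear_combination (-1 : ℝ) * hxn
  have hY' : ((i' : ℝ) + j') ^ 2 + ((i' : ℝ) + k') ^ 2 + ((j' : ℝ) + k') ^ 2 = 2 := by
    linear_combination (-1 : ℝ) * hyn
  have hXY' : ((i : ℝ) + j) * ((i' : ℝ) + j') + ((i : ℝ) + k) * ((i' : ℝ) + k') +
      ((j : ℝ) + k) * ((j' : ℝ) + k') = 0 := by
    linear_combination (-2 : ℝ) * hdot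
  have hX : (i + j) ^ 2 + (i + k) ^ 2 + (j + k) ^ 2 = 2 := by exact_mod_cast hX'
  have hY : (i' + j') ^ 2 + (i' + k') ^ 2 + (j' + k') ^ 2 = 2 := by exact_mod_cast hY'
  have hXY : (i + j) * (i' + j') + (i + k) * (i' + k') + (j + k) * (j' + k') = 0 := by
    exact_mod_cast hXY'
  obtain ⟨C, hC, C', hC', hne, h1, h2, h3, h4⟩ := square_apices_decide _ (mem_slotList_of_sq_eq_two _ _ _ hX)
    _ (mem_slotList_of_sq_eq_two _ _ _ hY) hXY
  obtain ⟨hCe, hCn⟩ := slotList_props C hC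
  obtain ⟨hCe', hCn'⟩ := slotList_props C' hC'
  obtain ⟨c₁, hc₁, a₁, b₁, e₁⟩ := exists_site_of_cubic C.1 C.2.1 C.2.2 hCe
  obtain ⟨c₂, hc₂, a₂, b₂, e₂⟩ := exists_site_of_cubic C'.1 C'.2.1 C'.2.2 hCe'
  have hn₁ := two_mul_norm_sq_eq_cubic c₁
  have hn₂ := two_mul_norm_sq_eq_cubic c₂
  rw [a₁, b₁, e₁] at hn₁
  rw [a₂, b₂, e₂] at hn₂
  have hCnr : ((C.1 : ℝ)) ^ 2 + ((C.2.1 : ℝ)) ^ 2 + ((C.2.2 : ℝ)) ^ 2 = 2 := by exact_mod_cast hCn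
  have hCnr' : ((C'.1 : ℝ)) ^ 2 + ((C'.2.1 : ℝ)) ^ 2 + ((C'.2.2 : ℝ)) ^ 2 = 2 := by exact_mod_cast hCn'
  have norm1 : ∀ c : EuclideanSpace ℝ (Fin 3), 2 * ‖c‖ ^ 2 = 2 → ‖c‖ = 1 := by
    intro c hc
    have h1 : ‖c‖ ^ 2 = 1 ^ 2 := by linear_combination (1 / 2 : ℝ) * hc
    exact (sq_eq_sq₀ (norm_nonneg c) zero_le_one).1 h1
  refine ⟨c₁, hc₁, c₂, hc₂, ?_, norm1 c₁ (hn₁.trans hCnr), norm1 c₂ (hn₂.trans hCnr'), ?_, ?_, ?_, ?_⟩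
  · intro heq
    apply hne
    rw [heq] at a₁ b₁ e₁
    have q1 : (C.1 : ℝ) = C'.1 := by rw [← a₁, a₂]
    have q2 : (C.2.1 : ℝ) = C'.2.1 := by rw [← b₁, b₂]
    have q3 : (C.2.2 : ℝ) = C'.2.2 := by rw [← e₁, e₂]
    exact Prod.ext (by exact_mod_cast q1) (Prod.ext (by exact_mod_cast q2) (by exact_mod_cast q3))
  · rw [inner_eq_half_cubic, a₁, b₁, e₁, xa, xb, xc]
    have : ((C.1 : ℝ)) * ((i : ℝ) + j) + (C.2.1 : ℝ) * ((i : ℝ) + k) + (C.2.2 : ℝ) * ((j : ℝ) + k) = 1 := by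
      exact_mod_cast h1
    rw [this]; norm_num
  · rw [inner_eq_half_cubic, a₁, b₁, e₁, ya, yb, yc]
    have : ((C.1 : ℝ)) * ((i' : ℝ) + j') + (C.2.1 : ℝ) * ((i' : ℝ) + k') + (C.2.2 : ℝ) * ((j' : ℝ) + k') = 1 := by
      exact_mod_cast h2
    rw [this]; norm_num
  · rw [inner_eq_half_cubic, a₂, b₂, e₂, xa, xb, xc]
    have : ((C'.1 : ℝ)) * ((i : ℝ) + j) + (C'.2.1 : ℝ) * ((i : ℝ) + k) + (C'.2.2 : ℝ) * ((j : ℝ) + k) = 1 := by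
      exact_mod_cast h3
    rw [this]; norm_num
  · rw [inner_eq_half_cubic, a₂, b₂, e₂, ya, yb, yc]
    have : ((C'.1 : ℝ)) * ((i' : ℝ) + j') + (C'.2.1 : ℝ) * ((i' : ℝ) + k') + (C'.2.2 : ℝ) * ((j' : ℝ) + k') = 1 := by
      exact_mod_cast h4
    rw [this]; norm_num

/-! ### The standard orthogonal pair `u₀ = site(0,1,0)`, `s₂ = site(1,0,−1)` and its two apices -/

/-- Coordinates of `s₂ = site(1,0,−1) = (0, −√3/3, √(2/3))` and of the apex `site(0,1,−1) =
(½, −√3/2, 0)`. -/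
theorem orthSlot_apply :
    (barlowPos 1 (Real.sqrt (2 / 3)) constHagg 1 0 (-1) 0 = 0 ∧
      barlowPos 1 (Real.sqrt (2 / 3)) constHagg 1 0 (-1) 1 = -(Real.sqrt 3 / 3) ∧
      barlowPos 1 (Real.sqrt (2 / 3)) constHagg 1 0 (-1) 2 = Real.sqrt (2 / 3)) ∧
    (barlowPos 1 (Real.sqrt (2 / 3)) constHagg 0 1 (-1) 0 = 1 / 2 ∧
      barlowPos 1 (Real.sqrt (2 / 3)) constHagg 0 1 (-1) 1 = -(Real.sqrt 3 / 2) ∧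
      barlowPos 1 (Real.sqrt (2 / 3)) constHagg 0 1 (-1) 2 = 0) ∧
    (barlowPos 1 (Real.sqrt (2 / 3)) constHagg 1 0 0 0 = 1 / 2 ∧
      barlowPos 1 (Real.sqrt (2 / 3)) constHagg 1 0 0 1 = Real.sqrt 3 / 6 ∧
      barlowPos 1 (Real.sqrt (2 / 3)) constHagg 1 0 0 2 = Real.sqrt (2 / 3)) := by
  simp only [barlowPos_apply_zero, barlowPos_apply_one, barlowPos_apply_two, haggLabel_const]
  push_cast
  refine ⟨⟨by ring, by ring, by ring⟩, ⟨by ring, by ring, by ring⟩, ⟨by ring, by ring, by ring⟩⟩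

/-- **The two apices over the standard square are `site(0,1,−1)` and `site(1,0,0)`**: a unit vector at
`60°` from both `u₀` and `s₂` is one of them. -/
theorem apex_eq_of_inner_half (c : EuclideanSpace ℝ (Fin 3)) (hc : ‖c‖ = 1)
    (hcu : ⟪c, barlowPos 1 (Real.sqrt (2 / 3)) constHagg 0 1 0⟫_ℝ = 1 / 2)
    (hcs : ⟪c, barlowPos 1 (Real.sqrt (2 / 3)) constHagg 1 0 (-1)⟫_ℝ = 1 / 2) :
    c = barlowPos 1 (Real.sqrt (2 / 3)) constHagg 0 1 (-1) ∨
      c = barlowPos 1 (Real.sqrt (2 / 3)) constHagg 1 0 0 := by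
  obtain ⟨⟨s0, s1, s2⟩, ⟨p0, p1, p2⟩, ⟨f0, f1, f2⟩⟩ := orthSlot_apply
  obtain ⟨u0, u1, u2⟩ := barlowPos_inLayer_apply (Real.sqrt (2 / 3)) constHagg 1 0
  have hinner : ∀ x y : EuclideanSpace ℝ (Fin 3), ⟪x, y⟫_ℝ = x 0 * y 0 + x 1 * y 1 + x 2 * y 2 :=
    fun x y => by simp [PiLp.inner_apply, Fin.sum_univ_three, mul_comm]
  rw [hinner, u0, u1, u2] at hcu
  rw [hinner, s0, s1, s2] at hcs
  push_cast at hcu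
  have e0 : c 0 = 1 / 2 := by linarith
  have hn := norm_sq_eq_fin3 c
  rw [hc, e0] at hn
  set r := Real.sqrt 3 with hr
  set t := Real.sqrt (2 / 3) with ht
  have hr3 : r * r = 3 := Real.mul_self_sqrt (by norm_num)
  have ht2 : t * t = 2 / 3 := Real.mul_self_sqrt (by norm_num)
  have htpos : 0 < t := Real.sqrt_pos.2 (by norm_num)
  have e1 : t * c 2 = 1 / 2 + r / 3 * c 1 := by linarith
  have h4 : 2 / 3 * c 2 ^ 2 = (1 / 2 + r / 3 * c 1) ^ 2 := by
    rw [← e1]; linear_combination (-(c 2 ^ 2)) * ht2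
  have e2 : c 1 ^ 2 + c 2 ^ 2 = 3 / 4 := by linarith
  have key : (c 1 + r / 2) * (c 1 - r / 6) = 0 := by
    linear_combination (-1 : ℝ) * h4 + (2 / 3 : ℝ) * e2 + (-(c 1 ^ 2) / 9 - 1 / 12) * hr3
  rcases mul_eq_zero.1 key with h | h
  · left
    have c1 : c 1 = -(r / 2) := by linarith
    have c2 : c 2 = 0 := by
      have : t * c 2 = 0 := by rw [e1, c1]; linear_combination (-1 / 6 : ℝ) * hr3
      exact (mul_eq_zero.1 this).resolve_left htpos.ne'
    exact eq_of_apply_fin3 (by rw [e0, p0]) (by rw [c1, p1]) (by rw [c2, p2])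
  · right
    have c1 : c 1 = r / 6 := by linarith
    have c2 : c 2 = t := by
      have : t * c 2 = t * t := by rw [e1, c1, ht2]; linear_combination (1 / 18 : ℝ) * hr3
      exact mul_left_cancel₀ htpos.ne' this
    exact eq_of_apply_fin3 (by rw [e0, f0]) (by rw [c1, f1]) (by rw [c2, f2])

/-! ### A frame through an orthogonal pair -/

/-- **A rigid frame through an orthogonal pair**: for orthonormal `a, b` there is a linear isometry
with `L u₀ = a` and `L s₂ = b`. -/
theorem exists_frame_isometry_orth (a b : EuclideanSpace ℝ (Fin 3)) (ha : ‖a‖ = 1) (hb : ‖b‖ = 1)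
    (hab : ⟪a, b⟫_ℝ = 0) :
    ∃ L : EuclideanSpace ℝ (Fin 3) ≃ₗᵢ[ℝ] EuclideanSpace ℝ (Fin 3),
      L (barlowPos 1 (Real.sqrt (2 / 3)) constHagg 0 1 0) = a ∧
        L (barlowPos 1 (Real.sqrt (2 / 3)) constHagg 1 0 (-1)) = b := by
  -- orthonormal triples on both sides
  have frame : ∀ x y : EuclideanSpace ℝ (Fin 3), ‖x‖ = 1 → ‖y‖ = 1 → ⟪x, y⟫_ℝ = 0 →
      ∃ B : OrthonormalBasis (Fin 3) ℝ (EuclideanSpace ℝ (Fin 3)), B 0 = x ∧ B 1 = y := by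
    intro x y hx hy hxy
    obtain ⟨w, hxw, hyw, hww⟩ := Summit.Ventures.Crystal3D.exists_frame_normal x y
    have h23 : Real.sqrt (2 / 3) * Real.sqrt (2 / 3) = 2 / 3 := Real.mul_self_sqrt (by norm_num)
    set z : EuclideanSpace ℝ (Fin 3) := Real.sqrt (2 / 3) • w with hz
    have hxx : ⟪x, x⟫_ℝ = 1 := by rw [real_inner_self_eq_norm_sq, hx, one_pow]
    have hyy : ⟪y, y⟫_ℝ = 1 := by rw [real_inner_self_eq_norm_sq, hy, one_pow]
    have hyx : ⟪y, x⟫_ℝ = 0 := by rw [real_inner_comm]; exact hxy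
    have hxz : ⟪x, z⟫_ℝ = 0 := by rw [hz, real_inner_smul_right, hxw, mul_zero]
    have hyz : ⟪y, z⟫_ℝ = 0 := by rw [hz, real_inner_smul_right, hyw, mul_zero]
    have hzx : ⟪z, x⟫_ℝ = 0 := by rw [real_inner_comm]; exact hxz
    have hzy : ⟪z, y⟫_ℝ = 0 := by rw [real_inner_comm]; exact hyz
    have hzz : ⟪z, z⟫_ℝ = 1 := by
      rw [hz, real_inner_smul_left, real_inner_smul_right, hww, ← mul_assoc, h23]; norm_num
    set v : Fin 3 → EuclideanSpace ℝ (Fin 3) := ![x, y, z] with hv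
    have hon : Orthonormal ℝ v := by
      rw [orthonormal_iff_ite]
      intro i j
      fin_cases i <;> fin_cases j
      · simpa [hv] using hxx
      · simpa [hv] using hxy
      · simpa [hv] using hxz
      · simpa [hv] using hyx
      · simpa [hv] using hyy
      · simpa [hv] using hyz
      · simpa [hv] using hzx
      · simpa [hv] using hzy
      · simpa [hv] using hzz
    have hsp : ⊤ ≤ Submodule.span ℝ (Set.range v) :=
      (hon.linearIndependent.span_eq_top_of_card_eq_finrank' (by simp)).ge
    refine ⟨OrthonormalBasis.mk hon hsp, ?_, ?_⟩
    · rw [OrthonormalBasis.coe_mk]; simp [hv]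
    · rw [OrthonormalBasis.coe_mk]; simp [hv]
  obtain ⟨nu, -, -⟩ := norm_barlowPos_generators isHaggSeq_const
  obtain ⟨⟨s0, s1, s2⟩, -, -⟩ := orthSlot_apply
  obtain ⟨u0, u1, u2⟩ := barlowPos_inLayer_apply (Real.sqrt (2 / 3)) constHagg 1 0
  have ns : ‖barlowPos 1 (Real.sqrt (2 / 3)) constHagg 1 0 (-1)‖ = 1 := by
    have h := norm_sq_eq_fin3 (barlowPos 1 (Real.sqrt (2 / 3)) constHagg 1 0 (-1))
    rw [s0, s1, s2] at h
    have h3 : Real.sqrt 3 ^ 2 = 3 := Real.sq_sqrt (by norm_num)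
    have h23 : Real.sqrt (2 / 3) ^ 2 = 2 / 3 := Real.sq_sqrt (by norm_num)
    have h1 : ‖barlowPos 1 (Real.sqrt (2 / 3)) constHagg 1 0 (-1)‖ ^ 2 = 1 ^ 2 := by
      rw [h]; nlinarith [h3, h23]
    exact (sq_eq_sq₀ (norm_nonneg _) zero_le_one).1 h1
  have hus : ⟪barlowPos 1 (Real.sqrt (2 / 3)) constHagg 0 1 0,
      barlowPos 1 (Real.sqrt (2 / 3)) constHagg 1 0 (-1)⟫_ℝ = 0 := by
    have hinner : ∀ p q : EuclideanSpace ℝ (Fin 3), ⟪p, q⟫_ℝ = p 0 * q 0 + p 1 * q 1 + p 2 * q 2 :=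
      fun p q => by simp [PiLp.inner_apply, Fin.sum_univ_three, mul_comm]
    rw [hinner, u0, u1, u2, s0]; push_cast; ring
  obtain ⟨Bs, hBs0, hBs1⟩ := frame _ _ nu ns hus
  obtain ⟨Bt, hBt0, hBt1⟩ := frame a b ha hb hab
  refine ⟨Bs.repr.trans Bt.repr.symm, ?_, ?_⟩
  · rw [LinearIsometryEquiv.trans_apply, ← hBs0, Bs.repr_self, Bt.repr_symm_single, hBt0]
  · rw [LinearIsometryEquiv.trans_apply, ← hBs1, Bs.repr_self, Bt.repr_symm_single, hBt1]

/-! ### The lattice is pinned by an orthogonal pair -/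

/-- **Rigid fcc lattices containing `u₀` and `s₂` are `Λ₀` itself.** -/
theorem image_eq_of_mem_orthogonal_slots (M : EuclideanSpace ℝ (Fin 3) ≃ₗᵢ[ℝ] EuclideanSpace ℝ (Fin 3))
    (hu : barlowPos 1 (Real.sqrt (2 / 3)) constHagg 0 1 0 ∈ M '' fccStacking 1 (Real.sqrt (2 / 3)))
    (hs : barlowPos 1 (Real.sqrt (2 / 3)) constHagg 1 0 (-1) ∈ M '' fccStacking 1 (Real.sqrt (2 / 3))) :
    M '' fccStacking 1 (Real.sqrt (2 / 3)) = fccStacking 1 (Real.sqrt (2 / 3)) := by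
  classical
  set G₁ : AddSubgroup (EuclideanSpace ℝ (Fin 3)) :=
    barlowAddSubgroupOfConst 1 (Real.sqrt (2 / 3)) constHagg (fun _ => rfl) with hG₁
  have hG₁mem : ∀ w, w ∈ G₁ ↔ w ∈ fccStacking 1 (Real.sqrt (2 / 3)) := fun w => Iff.rfl
  obtain ⟨x, hx, hxu⟩ := hu
  obtain ⟨y, hy, hys⟩ := hs
  obtain ⟨nu, nv, nf⟩ := norm_barlowPos_generators isHaggSeq_const
  obtain ⟨⟨s0, s1, s2⟩, -, -⟩ := orthSlot_apply
  obtain ⟨u0, u1, u2⟩ := barlowPos_inLayer_apply (Real.sqrt (2 / 3)) constHagg 1 0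
  have hinner : ∀ p q : EuclideanSpace ℝ (Fin 3), ⟪p, q⟫_ℝ = p 0 * q 0 + p 1 * q 1 + p 2 * q 2 :=
    fun p q => by simp [PiLp.inner_apply, Fin.sum_univ_three, mul_comm]
  have ns : ‖barlowPos 1 (Real.sqrt (2 / 3)) constHagg 1 0 (-1)‖ = 1 := by
    rw [← hys, LinearIsometryEquiv.norm_map]
    have h0 : (0 : EuclideanSpace ℝ (Fin 3)) ∈ fccStacking 1 (Real.sqrt (2 / 3)) :=
      ⟨0, 0, 0, (barlowPos_zero _ _).symm⟩
    obtain ⟨K, I, J, rfl⟩ := hy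
    -- it is the image of a unit vector: its norm is read off from the target
    have h := norm_sq_eq_fin3 (barlowPos 1 (Real.sqrt (2 / 3)) constHagg 1 0 (-1))
    rw [s0, s1, s2] at h
    have h3 : Real.sqrt 3 ^ 2 = 3 := Real.sq_sqrt (by norm_num)
    have h23 : Real.sqrt (2 / 3) ^ 2 = 2 / 3 := Real.sq_sqrt (by norm_num)
    have h1 : ‖barlowPos 1 (Real.sqrt (2 / 3)) constHagg 1 0 (-1)‖ ^ 2 = 1 ^ 2 := by
      rw [h]; nlinarith [h3, h23]
    rw [← LinearIsometryEquiv.norm_map M, hys]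
    exact (sq_eq_sq₀ (norm_nonneg _) zero_le_one).1 h1
  have hx1 : ‖x‖ = 1 := by rw [← LinearIsometryEquiv.norm_map M, hxu, nu]
  have hy1 : ‖y‖ = 1 := by rw [← LinearIsometryEquiv.norm_map M, hys, ns]
  have hxy : ⟪x, y⟫_ℝ = 0 := by
    rw [← LinearIsometryEquiv.inner_map_map M, hxu, hys, hinner, u0, u1, u2, s0]; push_cast; ring
  obtain ⟨c₁, hc₁, c₂, hc₂, hne, n₁, n₂, i₁x, i₁y, i₂x, i₂y⟩ := exists_two_apices hx hy hx1 hy1 hxy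
  -- the images of the apices are the two standard apices
  have img : ∀ c ∈ fccStacking 1 (Real.sqrt (2 / 3)), ‖c‖ = 1 → ⟪c, x⟫_ℝ = 1 / 2 → ⟪c, y⟫_ℝ = 1 / 2 →
      M c = barlowPos 1 (Real.sqrt (2 / 3)) constHagg 0 1 (-1) ∨
        M c = barlowPos 1 (Real.sqrt (2 / 3)) constHagg 1 0 0 := by
    intro c _ hc1 hcx hcy
    refine apex_eq_of_inner_half (M c) (by rw [LinearIsometryEquiv.norm_map, hc1]) ?_ ?_
    · rw [← hxu, LinearIsometryEquiv.inner_map_map, hcx]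
    · rw [← hys, LinearIsometryEquiv.inner_map_map, hcy]
  have both : barlowPos 1 (Real.sqrt (2 / 3)) constHagg 0 1 (-1) ∈ M '' fccStacking 1 (Real.sqrt (2 / 3)) ∧
      barlowPos 1 (Real.sqrt (2 / 3)) constHagg 1 0 0 ∈ M '' fccStacking 1 (Real.sqrt (2 / 3)) := by
    rcases img c₁ hc₁ n₁ i₁x i₁y with h₁ | h₁ <;> rcases img c₂ hc₂ n₂ i₂x i₂y with h₂ | h₂
    · exact absurd (M.injective (h₁.trans h₂.symm)) hne
    · exact ⟨⟨c₁, hc₁, h₁⟩, ⟨c₂, hc₂, h₂⟩⟩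
    · exact ⟨⟨c₂, hc₂, h₂⟩, ⟨c₁, hc₁, h₁⟩⟩
    · exact absurd (M.injective (h₁.trans h₂.symm)) hne
  obtain ⟨⟨p, hp, hpe⟩, ⟨q, hq, hqe⟩⟩ := both
  -- the three generators of `Λ₀` pulled back by `M⁻¹` are sites: generator capture for `M⁻¹`
  have hv₀ : M.symm (barlowPos 1 (Real.sqrt (2 / 3)) constHagg 0 0 1) ∈ fccStacking 1 (Real.sqrt (2 / 3)) := by
    have e : barlowPos 1 (Real.sqrt (2 / 3)) constHagg 0 0 1 =
        barlowPos 1 (Real.sqrt (2 / 3)) constHagg 0 1 0 - barlowPos 1 (Real.sqrt (2 / 3)) constHagg 0 1 (-1) := by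
      rw [eq_sub_iff_add_eq, barlowPos_inLayer_eq _ constHagg constHagg, barlowPos_add_inLayer]; norm_num
    rw [e, map_sub, ← hxu, ← hpe, LinearIsometryEquiv.symm_apply_apply, LinearIsometryEquiv.symm_apply_apply]
    exact (hG₁mem _).1 (G₁.sub_mem ((hG₁mem _).2 hx) ((hG₁mem _).2 hp))
  have hsymm := image_const_eq_of_generators (c₁ := 1) (c₂ := 1) (Or.inl rfl) (Or.inl rfl) M.symm
    (by
      show M.symm (barlowPos 1 (Real.sqrt (2 / 3)) constHagg 0 1 0) ∈ fccStacking 1 (Real.sqrt (2 / 3))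
      rw [← hxu, LinearIsometryEquiv.symm_apply_apply]; exact hx)
    hv₀
    (by
      show M.symm (barlowPos 1 (Real.sqrt (2 / 3)) constHagg 1 0 0) ∈ fccStacking 1 (Real.sqrt (2 / 3))
      rw [← hqe, LinearIsometryEquiv.symm_apply_apply]; exact hq)
  have e1 : fccStacking 1 (Real.sqrt (2 / 3)) = barlowStacking 1 (Real.sqrt (2 / 3)) (fun _ : ℤ => (1 : ℤ)) := rfl
  have himg : M '' (M.symm '' barlowStacking 1 (Real.sqrt (2 / 3)) (fun _ : ℤ => (1 : ℤ))) =
      barlowStacking 1 (Real.sqrt (2 / 3)) (fun _ : ℤ => (1 : ℤ)) := by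
    rw [Set.image_image]; simp
  rw [hsymm] at himg
  rw [e1]; exact himg

/-- **Two fcc lattices sharing an orthogonal pair of unit vectors are EQUAL** (as linear lattices). -/
theorem eq_of_shared_orthogonal_slots (A₁ A₂ : EuclideanSpace ℝ (Fin 3) ≃ₗᵢ[ℝ] EuclideanSpace ℝ (Fin 3))
    (a b : EuclideanSpace ℝ (Fin 3))
    (ha₁ : a ∈ A₁ '' fccStacking 1 (Real.sqrt (2 / 3))) (hb₁ : b ∈ A₁ '' fccStacking 1 (Real.sqrt (2 / 3)))
    (ha₂ : a ∈ A₂ '' fccStacking 1 (Real.sqrt (2 / 3))) (hb₂ : b ∈ A₂ '' fccStacking 1 (Real.sqrt (2 / 3)))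
    (ha : ‖a‖ = 1) (hb : ‖b‖ = 1) (hab : ⟪a, b⟫_ℝ = 0) :
    A₁ '' fccStacking 1 (Real.sqrt (2 / 3)) = A₂ '' fccStacking 1 (Real.sqrt (2 / 3)) := by
  obtain ⟨L, hLu, hLs⟩ := exists_frame_isometry_orth a b ha hb hab
  have key : ∀ A : EuclideanSpace ℝ (Fin 3) ≃ₗᵢ[ℝ] EuclideanSpace ℝ (Fin 3),
      a ∈ A '' fccStacking 1 (Real.sqrt (2 / 3)) → b ∈ A '' fccStacking 1 (Real.sqrt (2 / 3)) →
      A '' fccStacking 1 (Real.sqrt (2 / 3)) = L '' fccStacking 1 (Real.sqrt (2 / 3)) := by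
    intro A haA hbA
    set M : EuclideanSpace ℝ (Fin 3) ≃ₗᵢ[ℝ] EuclideanSpace ℝ (Fin 3) := A.trans L.symm with hM
    have hMw : ∀ x, M x = L.symm (A x) := fun x => rfl
    have pull : ∀ {x y : EuclideanSpace ℝ (Fin 3)}, x ∈ A '' fccStacking 1 (Real.sqrt (2 / 3)) →
        L y = x → y ∈ M '' fccStacking 1 (Real.sqrt (2 / 3)) := by
      rintro x y ⟨p, hp, rfl⟩ hy
      exact ⟨p, hp, by rw [hMw, ← hy, LinearIsometryEquiv.symm_apply_apply]⟩
    have hMeq := image_eq_of_mem_orthogonal_slots M (pull haA hLu) (pull hbA hLs)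
    have hLM : A '' fccStacking 1 (Real.sqrt (2 / 3)) = L '' (M '' fccStacking 1 (Real.sqrt (2 / 3))) := by
      rw [Set.image_image]
      exact Set.image_congr fun x _ => by rw [hMw, LinearIsometryEquiv.apply_symm_apply]
    rw [hLM, hMeq]
  rw [key A₁ ha₁ hb₁, key A₂ ha₂ hb₂]

end Summit.Ventures.Crystal3D.Theorems

end
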